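import Literature.AlgebraicGeometry.ModuliOfAbelianVarieties.SiegelPrincipalLevelOpen
import Literature.NumberTheory.Automorphic.MeyerUnramifiedReduction
import Literature.NumberTheory.Automorphic.NewformAdelisation
import Literature.NumberTheory.Automorphic.AdeleRingStrongApproximation
import HarnessLib

/-!
# The principal congruence levels form a neighbourhood basis of `1` in `GL_n(𝔸_{ℚ,f})` and `GSp(𝔸_{ℚ,f})`

Topic: `Literature/NumberTheory/Adeles`. THEOREMS ONLY (no definition, no named fact, no instance,
no `sorry`). Cell `hodgecm-mathlib` (D-0151), T3 (I-1′ receptacle) — B-p03's Q6b carve-out (NB),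
consumed by `…UnitaryAuxiliaryCarrierEmbedding.lean` / the `stub_frame` closer; banked leaf, no
floor change.

* `levelIdeal_subset_levelIdeal_span` / `levelIdeal_span_subset_levelIdeal` — the cell's
  `N·𝓞̂ ⊂ 𝔸_{ℚ,f}` (`Literature.AlgebraicGeometry.ModuliOfAbelianVarieties.levelIdeal N`, «`x = N·y`, `y` integral») IS the
  valuation-defined level ideal `(N)𝓞̂` of the automorphic files
  (`Literature.NumberTheory.Automorphic.levelIdeal ℚ (N)`, «`|x_v|_v ≤ |N|_v` for all `v`»).
* `exists_levelIdeal_subset_of_mem_nhds` — every neighbourhood of `0 ∈ 𝔸_{ℚ,f}` contains some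
  `N·𝓞̂`, `N ≥ 1` (the `N·𝓞̂` are a neighbourhood basis of `0`).
* `exists_setOf_isCongOne_subset_of_mem_nhds` — every neighbourhood of `1 ∈ GL_n(𝔸_{ℚ,f})`
  contains a principal congruence set `{γ | γ ≡ 1, γ⁻¹ ≡ 1 (mod N·𝓞̂)}`, `N ≥ 1`.
* `exists_principalLevelSubgroup_subset_of_mem_nhds` — every neighbourhood of `1` in
  `GSp_δ(𝔸_{ℚ,f})` contains a principal level `K_δ(N)`, `N ≥ 1`.

Together with ★ `isOpen_levelIdeal` / `isOpen_principalLevelSubgroup` (`SiegelPrincipalLevelOpen`):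
the `K_δ(N)` form a basis of open neighbourhoods of the identity (Deligne, *Travaux de Shimura*,
Exemple 4.16: «les `K(N)` … forment un système fondamental de voisinages de l'unité»;
Platonov–Rapinchuk Ch. 5 §5.1: the congruence subgroups `GL_n(Ẑ, N)` are a base of neighbourhoods
of the identity in `GL_n(𝔸_f)`).

## References

* P. Deligne, *Travaux de Shimura*, Sém. Bourbaki 389 (1971), 0.4 p. 125, Exemple 4.16 p. 150.
  [Deligne1971TravauxShimura]
* V. Platonov, A. Rapinchuk, *Algebraic Groups and Number Theory*, Academic Press 1994, Ch. 5
  §5.1. [PlatonovRapinchuk1994]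
-/

noncomputable section

open IsDedekindDomain NumberField Topology Filter
open Literature.AlgebraicGeometry.ModuliOfAbelianVarieties

namespace Literature.NumberTheory.Adeles

/-! ### §1. `N·𝓞̂` versus the valuation-defined level ideal `(N)𝓞̂` -/

/-- Membership in the integral adeles `𝓞̂ ⊂ 𝔸_{ℚ,f}` is integrality at every finite place:
`|y_v|_v ≤ 1` for all `v`. [folklore] -/
private theorem mem_integralAdeles_iff_forall (y : finAdeleQ) :
    y ∈ FiniteAdeleRing.integralAdeles (𝓞 ℚ) ℚ ↔ ∀ v, Valued.v (y v) ≤ 1 := by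
  have h : (FiniteAdeleRing.integralAdeles (𝓞 ℚ) ℚ : Set finAdeleQ) =
      (Literature.NumberTheory.Automorphic.integralFiniteAdeles ℚ : Set finAdeleQ) := by
    rw [Literature.NumberTheory.Automorphic.coe_integralFiniteAdeles_eq_range_structureMap]
    rfl
  have h' : y ∈ FiniteAdeleRing.integralAdeles (𝓞 ℚ) ℚ ↔
      y ∈ Literature.NumberTheory.Automorphic.integralFiniteAdeles ℚ := by
    rw [← SetLike.mem_coe, h, SetLike.mem_coe]
  rw [h', Literature.NumberTheory.Automorphic.mem_integralFiniteAdeles_iff]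
  exact forall_congr' fun v => HeightOneSpectrum.mem_adicCompletionIntegers (𝓞 ℚ) ℚ v

/-- `|N|_v = |(N)|_v`: the valuation of the finite adele `N` at `v` is the radius of the ideal
`(N) ⊆ ℤ` at `v`. [folklore] -/
private theorem valued_natCast_apply {N : ℕ} (hN : N ≠ 0) (v : HeightOneSpectrum (𝓞 ℚ)) :
    Valued.v ((N : finAdeleQ) v) = Literature.NumberTheory.Automorphic.idealRadius ℚ v (Ideal.span {(N : 𝓞 ℚ)}) := by
  have h : (N : finAdeleQ) = algebraMap ℚ finAdeleQ (N : ℚ) := (map_natCast (algebraMap ℚ finAdeleQ) N).symm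
  rw [h, Literature.NumberTheory.Automorphic.valued_algebraMap_finiteAdele_apply,
    Literature.NumberTheory.Automorphic.Rat.idealRadius_span_natCast v hN]

/-- **`N·𝓞̂ ⊆ (N)𝓞̂`**: a finite adele of the form `N·y` with `y` integral has `|x_v|_v ≤ |N|_v`
at every finite place. [cite: Deligne1971TravauxShimura, Exemple 4.16 p. 150] -/
theorem levelIdeal_subset_levelIdeal_span {N : ℕ} (hN : N ≠ 0) :
    (Literature.AlgebraicGeometry.ModuliOfAbelianVarieties.levelIdeal N : Set finAdeleQ) ⊆
      Literature.NumberTheory.Automorphic.levelIdeal ℚ (Ideal.span {(N : 𝓞 ℚ)}) := by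
  intro x hx
  obtain ⟨y, hy, rfl⟩ := Literature.AlgebraicGeometry.ModuliOfAbelianVarieties.mem_levelIdeal_iff.1 hx
  rw [SetLike.mem_coe, Literature.NumberTheory.Automorphic.mem_levelIdeal_iff]
  intro v
  rw [show ((N : finAdeleQ) * y) v = (N : finAdeleQ) v * y v from rfl, Valuation.map_mul,
    valued_natCast_apply hN v]
  exact mul_le_of_le_one_right' ((mem_integralAdeles_iff_forall y).1 hy v)

/-- **`(N)𝓞̂ ⊆ N·𝓞̂`**: if `|x_v|_v ≤ |N|_v` at every finite place then `N⁻¹·x` is integral, so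
`x = N·(N⁻¹x) ∈ N·𝓞̂`. [cite: Deligne1971TravauxShimura, Exemple 4.16 p. 150] -/
theorem levelIdeal_span_subset_levelIdeal {N : ℕ} (hN : N ≠ 0) :
    (Literature.NumberTheory.Automorphic.levelIdeal ℚ (Ideal.span {(N : 𝓞 ℚ)}) : Set finAdeleQ) ⊆
      Literature.AlgebraicGeometry.ModuliOfAbelianVarieties.levelIdeal N := by
  intro x hx
  rw [SetLike.mem_coe, Literature.NumberTheory.Automorphic.mem_levelIdeal_iff] at hx
  rw [SetLike.mem_coe, mem_levelIdeal_iff_inv_mul_mem hN, mem_integralAdeles_iff_forall]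
  intro v
  set u : finAdeleQˣ := (isUnit_natCast_finAdeleQ hN).unit with hu
  have huv : Valued.v ((u : finAdeleQ) v) * Valued.v (((u⁻¹ : finAdeleQˣ) : finAdeleQ) v) = 1 := by
    rw [← Valuation.map_mul, ← show ((u : finAdeleQ) * ((u⁻¹ : finAdeleQˣ) : finAdeleQ)) v =
      (u : finAdeleQ) v * ((u⁻¹ : finAdeleQˣ) : finAdeleQ) v from rfl, Units.mul_inv]
    exact Valuation.map_one _
  have hNv : Valued.v ((u : finAdeleQ) v) = Literature.NumberTheory.Automorphic.idealRadius ℚ v (Ideal.span {(N : 𝓞 ℚ)}) :=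
    valued_natCast_apply hN v
  have hNv0 : Valued.v ((u : finAdeleQ) v) ≠ 0 := by
    intro h0
    rw [h0, zero_mul] at huv
    exact zero_ne_one huv
  rw [show ((((u⁻¹ : finAdeleQˣ) : finAdeleQ)) * x) v = ((u⁻¹ : finAdeleQˣ) : finAdeleQ) v * x v from rfl,
    Valuation.map_mul]
  have hx' := hx v
  rw [← hNv] at hx'
  calc Valued.v (((u⁻¹ : finAdeleQˣ) : finAdeleQ) v) * Valued.v (x v)
      ≤ Valued.v (((u⁻¹ : finAdeleQˣ) : finAdeleQ) v) * Valued.v ((u : finAdeleQ) v) :=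
        mul_le_mul_right hx' _
    _ = 1 := by rw [mul_comm, huv]

/-! ### §2. `N·𝓞̂`, `N ≥ 1`, is a neighbourhood basis of `0 ∈ 𝔸_{ℚ,f}` -/

/-- **Every neighbourhood of `0` in `𝔸_{ℚ,f}` contains some `N·𝓞̂` with `N ≥ 1`**: a neighbourhood
contains a valuation box `𝔫𝓞̂` (`𝔫 ≠ 0`, ★ `Automorphic.exists_levelIdeal_subset`), and
`N·𝓞̂ ⊆ (N)𝓞̂ ⊆ 𝔫𝓞̂` for `N := Nm(𝔫) ∈ 𝔫`.
[cite: Deligne1971TravauxShimura, Exemple 4.16 p. 150] [cite: PlatonovRapinchuk1994, Ch. 5 §5.1] -/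
theorem exists_levelIdeal_subset_of_mem_nhds {V : Set finAdeleQ} (hV : V ∈ 𝓝 (0 : finAdeleQ)) :
    ∃ N : ℕ, N ≠ 0 ∧ (Literature.AlgebraicGeometry.ModuliOfAbelianVarieties.levelIdeal N : Set finAdeleQ) ⊆ V := by
  obtain ⟨𝔫, h𝔫, hsub⟩ := Literature.NumberTheory.Automorphic.Meyer.exists_levelIdeal_subset hV
  have hN0 : Ideal.absNorm 𝔫 ≠ 0 := by
    rw [Ne, Ideal.absNorm_eq_zero_iff]
    exact h𝔫
  refine ⟨Ideal.absNorm 𝔫, hN0, ?_⟩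
  have hle : Ideal.span {((Ideal.absNorm 𝔫 : ℕ) : 𝓞 ℚ)} ≤ 𝔫 := by
    rw [Ideal.span_singleton_le_iff_mem]
    exact Ideal.absNorm_mem 𝔫
  have hspan0 : Ideal.span {((Ideal.absNorm 𝔫 : ℕ) : 𝓞 ℚ)} ≠ 0 := by
    rw [Ne, Submodule.zero_eq_bot, Ideal.span_singleton_eq_bot]
    exact_mod_cast hN0
  have hmono : (Literature.NumberTheory.Automorphic.levelIdeal ℚ
        (Ideal.span {((Ideal.absNorm 𝔫 : ℕ) : 𝓞 ℚ)}) : Set finAdeleQ) ⊆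
      Literature.NumberTheory.Automorphic.levelIdeal ℚ 𝔫 :=
    fun x hx => Literature.NumberTheory.Automorphic.levelIdeal_mono ℚ hspan0 hle hx
  exact (levelIdeal_subset_levelIdeal_span hN0).trans (hmono.trans hsub)

/-! ### §3. Principal congruence sets are a neighbourhood basis of `1 ∈ GL_n(𝔸_{ℚ,f})` -/

variable {n : Type} [Fintype n] [DecidableEq n]

/-- A matrix neighbourhood of `1` contains a congruence box: for `O ∈ 𝓝 (1 : M_n(𝔸_{ℚ,f}))` there
is `N ≥ 1` with `{A | A ≡ 1 (mod N·𝓞̂)} ⊆ O` (product topology on the `n²` entries, `N` a common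
multiple of the entrywise levels). [folklore] -/
private theorem exists_setOf_isCongOne_subset_matrix {O : Set (Matrix n n finAdeleQ)}
    (hO : O ∈ 𝓝 (1 : Matrix n n finAdeleQ)) :
    ∃ N : ℕ, N ≠ 0 ∧ {A : Matrix n n finAdeleQ | IsCongOne N A} ⊆ O := by
  classical
  -- translate to a neighbourhood of `0` in `n × n → 𝔸` through `c ↦ 1 + c`
  let Ψ : (n × n → finAdeleQ) → Matrix n n finAdeleQ := fun c => 1 + Matrix.of fun i j => c (i, j)
  have hΨ : Continuous Ψ := by
    refine continuous_const.add ?_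
    refine continuous_matrix fun i j => ?_
    exact continuous_apply (i, j)
  have hΨ0 : Ψ 0 = 1 := by
    ext i j
    simp [Ψ]
  have hO' : Ψ ⁻¹' O ∈ 𝓝 (0 : n × n → finAdeleQ) := hΨ.continuousAt.preimage_mem_nhds (by rw [hΨ0]; exact hO)
  rw [nhds_pi, Filter.mem_pi] at hO'
  obtain ⟨I, -, t, ht, hIt⟩ := hO'
  -- entrywise levels
  have hk : ∀ k : n × n, ∃ N : ℕ, N ≠ 0 ∧ (Literature.AlgebraicGeometry.ModuliOfAbelianVarieties.levelIdeal N : Set finAdeleQ) ⊆ t k :=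
    fun k => exists_levelIdeal_subset_of_mem_nhds (by simpa using ht k)
  choose Nk hNk hNkt using hk
  refine ⟨∏ k, Nk k, Finset.prod_ne_zero_iff.2 fun k _ => hNk k, fun A hA => ?_⟩
  have hmem : (fun k : n × n => (A - 1) k.1 k.2) ∈ Set.pi I t := by
    intro k _
    exact hNkt k (levelIdeal_anti (Finset.dvd_prod_of_mem _ (Finset.mem_univ k)) (hA k.1 k.2))
  have hAeq : Ψ (fun k : n × n => (A - 1) k.1 k.2) = A := by
    ext i j
    simp [Ψ]
  have := hIt hmem
  rwa [Set.mem_preimage, hAeq] at this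

/-- **Every neighbourhood of `1` in `GL_n(𝔸_{ℚ,f})` contains a principal congruence set
`{γ | γ ≡ 1 and γ⁻¹ ≡ 1 (mod N·𝓞̂)}` with `N ≥ 1`** (units topology = the one induced by
`γ ↦ (γ, γ⁻¹)` into `M_n × M_nᵐᵒᵖ`; each factor contains a congruence box).
[cite: Deligne1971TravauxShimura, Exemple 4.16 p. 150] [cite: PlatonovRapinchuk1994, Ch. 5 §5.1] -/
theorem exists_setOf_isCongOne_subset_of_mem_nhds {W : Set (GL n finAdeleQ)}
    (hW : W ∈ 𝓝 (1 : GL n finAdeleQ)) :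
    ∃ N : ℕ, N ≠ 0 ∧ {γ : GL n finAdeleQ | IsCongOne N (γ : Matrix n n finAdeleQ) ∧
      IsCongOne N ((γ⁻¹ : GL n finAdeleQ) : Matrix n n finAdeleQ)} ⊆ W := by
  rw [Units.isInducing_embedProduct.nhds_eq_comap, Filter.mem_comap] at hW
  obtain ⟨O, hO, hOW⟩ := hW
  rw [Units.embedProduct_apply, Units.val_one, inv_one, Units.val_one] at hO
  obtain ⟨O₁, hO₁, O₂, hO₂, hprod⟩ := mem_nhds_prod_iff.1 hO
  have hO₂' : MulOpposite.op ⁻¹' O₂ ∈ 𝓝 (1 : Matrix n n finAdeleQ) :=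
    MulOpposite.continuous_op.continuousAt.preimage_mem_nhds (by simpa using hO₂)
  obtain ⟨N₁, hN₁, h₁⟩ := exists_setOf_isCongOne_subset_matrix hO₁
  obtain ⟨N₂, hN₂, h₂⟩ := exists_setOf_isCongOne_subset_matrix hO₂'
  refine ⟨N₁ * N₂, mul_ne_zero hN₁ hN₂, fun γ hγ => hOW ?_⟩
  rw [Set.mem_preimage, Units.embedProduct_apply]
  refine hprod ⟨h₁ (hγ.1.of_dvd (dvd_mul_right N₁ N₂)), ?_⟩
  exact h₂ (hγ.2.of_dvd (dvd_mul_left N₂ N₁))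

/-! ### §4. The principal levels `K_δ(N)` are a neighbourhood basis of `1 ∈ GSp_δ(𝔸_{ℚ,f})` -/

/-- **Every neighbourhood of `1` in `GSp_δ(𝔸_{ℚ,f})` contains a principal level `K_δ(N)`, `N ≥ 1`**
(subspace topology from `GL_{2g}(𝔸_{ℚ,f})`); with ★ `isOpen_principalLevelSubgroup` the `K_δ(N)`
form a fundamental system of open neighbourhoods of the identity.
[cite: Deligne1971TravauxShimura, Exemple 4.16 p. 150] [cite: PlatonovRapinchuk1994, Ch. 5 §5.1] -/
theorem exists_principalLevelSubgroup_subset_of_mem_nhds {g : ℕ} (δ : Fin g → ℕ)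
    {W : Set (gspFinAdelic δ)} (hW : W ∈ 𝓝 (1 : gspFinAdelic δ)) :
    ∃ N : ℕ, N ≠ 0 ∧ (principalLevelSubgroup δ N : Set (gspFinAdelic δ)) ⊆ W := by
  rw [nhds_subtype, Filter.mem_comap] at hW
  obtain ⟨W', hW', hsub⟩ := hW
  obtain ⟨N, hN, hNW⟩ := exists_setOf_isCongOne_subset_of_mem_nhds (n := Fin g ⊕ Fin g) hW'
  refine ⟨N, hN, fun γ hγ => hsub ?_⟩
  rw [Set.mem_preimage]
  exact hNW ((mem_principalLevelSubgroup_iff δ).1 hγ)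

end Literature.NumberTheory.Adeles

end
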